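import Summits.QuantumFields.YangMills.Theorems.VirialFluxGapCentralField
import Summits.QuantumFields.YangMills.Theorems.VirialFluxGapMassBracket
import Summits.QuantumFields.YangMills.Theorems.VirialFluxGapCentralLiftProximity
import Literature.Geometry.Lorentzian.KerrFarEnergyComparison
import HarnessLib

/-!
# Route `VirialFluxGap` (YangMills): (P4) FOR THE EXPLICIT CENTRAL FIELD — the field does not shrink the regularity masses by more than
# `330L²·√F₀`: `Σ_va centralCoeff_va·∂_va m_k ≥ −330L²√F₀(P)` at the central window points (MASS MONOTONICITY)

Toward the deciding crux `VirialFluxGap.PeriodicSoftness` (item stmt-QuantumFields-24141).  Hypothesis (P4) of the assembler's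
✓`periodicSoftness_of_signPlug` ∕ ✓`periodicSoftness_of_centralField` asks, for the four regularity masses `m` (w2's ✓`linkMass k`, ✓`seamMass`),
`−N√F_fix ≤ Σ_va C_va·∂_va m` along the central field.  For w3's explicit field `centralCoeff L σ σ₄` (✓`VirialFluxGapCentralFieldDefs`) the
bracket is a single-slot pairing (w2 ✓`sum_mul_frameD_linkMass_quat`): `2q₀⟨p, Im(c̄q) + ½σ_k z_k⟩` with `q = (q₀,p) = su2Quat(w_k)`, `c = liftQuat σ_k z_k`
the central lift of the block average (✓`centralDir_wrap`).  Writing `d = q − c`: the bracket equals `σ_k q₀|p|² − 2q₀|p|²·d₀ + (2q₀² − σ_kq₀)·(p·d⃗)`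
— a NON-NEGATIVE main term plus `O(‖d‖)`, and `‖d‖ ≤ √17·16L²·√F₀` by w3's ✓`norm_sq_wrapRep_sub_lift_blockIm_le`.

* §1 `anchored_bracket_eq` (the identity), `anchored_bracket_lower` (`≥ −5‖q − c‖`, pure quaternion algebra; Cauchy–Schwarz in `ℝ³` is the
  landed ✓`Literature.Geometry.Lorentzian.Kerr.sq_dot_le_three`);
* §2 ★★ `central_linkMass_bracket_lower` — at an `X_fix` point with `½ ≤ σ_k·Re q(w_k)` and `|z_k|² ≤ ½`:
  `−330·L²·√F_fix ≤ Σ_va centralCoeff L σ σ₄ va M_x · frameD (fixFrameStd va) (linkMass k) M_x`;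
  ★★ `central_seamMass_bracket_lower` — the seam twin (`12L²` in place of `16L²`).

HONEST LABEL: one hypothesis ((P4)) of a CONDITIONAL assembly discharged for the explicit field, modulo the smallness `|z|² ≤ ½` (a window
condition); (P2), (P3) remain (w3 lineage); nothing is closed; ⟨24141⟩, ⟨22884⟩ remain OPEN; the Yang–Mills mass gap is NOT proved; no summit
is proved by a line.  THEOREMS ONLY (0 `def`, 0 `sorry`), standard axioms.  Explicit-unit seat `ym-line-fcl-p3` g41 (cell ym-idea-1, free hands;
assembler), `--supports stmt-QuantumFields-24141`.  References: [cite: Luscher1983, §2]; [cite: CosteEtAl1985]; [folklore].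
-/

set_option autoImplicit false

noncomputable section

open scoped Matrix BigOperators ContDiff Topology Quaternion
open MeasureTheory Set Matrix
open Literature.MathematicalPhysics.QuantumFieldTheory hiding SU2
open Literature.MathematicalPhysics.QuantumLattice
open Literature.MathematicalPhysics.QuantumFieldTheory.SUNBakryEmery (expSU coe_expSU matTop)

namespace Summit.QuantumFields.YangMills.Theorems.VirialFluxGap.FrameHessian

open Summit.QuantumFields.YangMills.Theorems.FemtoTransferGap
open Summit.QuantumFields.YangMills.Theorems.FemtoTransferGap.TT
open Summit.QuantumFields.YangMills.Theorems.FemtoTransferGap.TwoLattice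
open Summit.QuantumFields.YangMills.Theorems.FemtoTransferGap.TwoLattice.Flat
open Summit.QuantumFields.YangMills.Theorems.VirialFluxGap.RingDeficit
open Summit.QuantumFields.YangMills.Theorems.VirialFluxGap.FrameDerivative
open Summit.QuantumFields.YangMills.Theorems.ToronValleyVolume.Lojasiewicz
open Summit.QuantumFields.YangMills.Theorems.VirialFluxGap.FixFrame
open Summit.QuantumFields.YangMills.Theorems.VirialFluxGap.RegCutoff
open Summit.QuantumFields.YangMills.Theorems.VirialFluxGap.CentralField
open Summit.QuantumFields.YangMills.Theorems.VirialFluxGap.CentralCoercivity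

variable {L : ℕ} [NeZero L]

open scoped Matrix.Norms.Frobenius

/-! ## §1 The anchored bracket: identity and lower bound -/

omit [NeZero L] in
/-- **The anchored bracket identity**: with `d = q − c`,
`2q₀⟨p, Im(c̄q) + ½σ·Im c⟩ = σq₀|p|² − 2q₀|p|²·d₀ + (2q₀² − σq₀)·(p·d⃗)` (`q = (q₀, p)`). [folklore] -/
theorem anchored_bracket_eq (q c : ℍ) (σ : ℝ) :
    2 * q.re * (q.imI * ((star c * q).imI + 1 / 2 * σ * c.imI) + q.imJ * ((star c * q).imJ + 1 / 2 * σ * c.imJ) +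
        q.imK * ((star c * q).imK + 1 / 2 * σ * c.imK)) =
      σ * q.re * (q.imI ^ 2 + q.imJ ^ 2 + q.imK ^ 2) +
        (-(2 * q.re * (q.imI ^ 2 + q.imJ ^ 2 + q.imK ^ 2))) * (q.re - c.re) +
        (2 * q.re ^ 2 - σ * q.re) * (q.imI * (q.imI - c.imI) + q.imJ * (q.imJ - c.imJ) + q.imK * (q.imK - c.imK)) := by
  simp only [Quaternion.imI_mul, Quaternion.imJ_mul, Quaternion.imK_mul, Quaternion.re_star, Quaternion.imI_star,
    Quaternion.imJ_star, Quaternion.imK_star]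
  ring

omit [NeZero L] in
/-- ★ **The anchored bracket is non-negative up to `5‖q − c‖`**: for a unit quaternion `q = (q₀,p)` with `σq₀ ≥ 0` (`σ = ±1`) and any `c`,
`2q₀⟨p, Im(c̄q) + ½σ·Im c⟩ ≥ −5·‖q − c‖` (main term `σq₀|p|² ≥ 0`; `|q₀|, |p| ≤ 1`). [folklore] -/
theorem anchored_bracket_lower (q c : ℍ) {σ : ℝ} (hσ : σ = 1 ∨ σ = -1)
    (hq : q.re ^ 2 + q.imI ^ 2 + q.imJ ^ 2 + q.imK ^ 2 = 1) (hσq : 0 ≤ σ * q.re) :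
    -(5 * ‖q - c‖) ≤ 2 * q.re * (q.imI * ((star c * q).imI + 1 / 2 * σ * c.imI) + q.imJ * ((star c * q).imJ + 1 / 2 * σ * c.imJ) +
        q.imK * ((star c * q).imK + 1 / 2 * σ * c.imK)) := by
  rw [anchored_bracket_eq]
  set P2 := q.imI ^ 2 + q.imJ ^ 2 + q.imK ^ 2 with hP2
  set pd := q.imI * (q.imI - c.imI) + q.imJ * (q.imJ - c.imJ) + q.imK * (q.imK - c.imK) with hpd
  have hσ2 : σ ^ 2 = 1 := by rcases hσ with rfl | rfl <;> norm_num
  have hP2n : 0 ≤ P2 := by rw [hP2]; positivity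
  have hP21 : P2 ≤ 1 := by nlinarith [sq_nonneg q.re]
  have hq0 : q.re ^ 2 ≤ 1 := by nlinarith [hP2n]
  -- the norm of `d = q − c`
  have hnorm : ‖q - c‖ ^ 2 = (q.re - c.re) ^ 2 + ((q.imI - c.imI) * (q.imI - c.imI) + (q.imJ - c.imJ) * (q.imJ - c.imJ) +
      (q.imK - c.imK) * (q.imK - c.imK)) := by
    have h := norm_sq_eq_re_sq_add_imDot (q - c)
    simpa only [Quaternion.re_sub, Quaternion.imI_sub, Quaternion.imJ_sub, Quaternion.imK_sub] using h
  have hn0 : 0 ≤ ‖q - c‖ := norm_nonneg _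
  -- `|d₀| ≤ ‖d‖`
  have hd0 : |q.re - c.re| ≤ ‖q - c‖ := by
    refine abs_le_of_sq_le_sq ?_ hn0
    rw [hnorm]; nlinarith [sq_nonneg (q.imI - c.imI), sq_nonneg (q.imJ - c.imJ), sq_nonneg (q.imK - c.imK)]
  -- `|p·d⃗| ≤ ‖d‖`
  have hpd : |pd| ≤ ‖q - c‖ := by
    refine abs_le_of_sq_le_sq ?_ hn0
    have hcs : (q.imI * (q.imI - c.imI) + q.imJ * (q.imJ - c.imJ) + q.imK * (q.imK - c.imK)) ^ 2 ≤
        (q.imI ^ 2 + q.imJ ^ 2 + q.imK ^ 2) * ((q.imI - c.imI) ^ 2 + (q.imJ - c.imJ) ^ 2 + (q.imK - c.imK) ^ 2) :=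
      Literature.Geometry.Lorentzian.Kerr.sq_dot_le_three _ _ _ _ _ _
    have hD : 0 ≤ (q.imI - c.imI) ^ 2 + (q.imJ - c.imJ) ^ 2 + (q.imK - c.imK) ^ 2 := by positivity
    calc pd ^ 2 ≤ P2 * ((q.imI - c.imI) ^ 2 + (q.imJ - c.imJ) ^ 2 + (q.imK - c.imK) ^ 2) := by rw [hpd, hP2]; exact hcs
      _ ≤ 1 * ((q.imI - c.imI) ^ 2 + (q.imJ - c.imJ) ^ 2 + (q.imK - c.imK) ^ 2) := mul_le_mul_of_nonneg_right hP21 hD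
      _ ≤ ‖q - c‖ ^ 2 := by rw [hnorm]; nlinarith [sq_nonneg (q.re - c.re)]
  -- the coefficients
  have hα : |(-(2 * q.re * P2))| ≤ 2 := by
    rw [abs_neg, abs_mul, abs_mul, abs_of_nonneg hP2n, abs_two]
    have : |q.re| ≤ 1 := abs_le_of_sq_le_sq (by simpa using hq0) zero_le_one
    nlinarith [abs_nonneg q.re]
  have hβ : |2 * q.re ^ 2 - σ * q.re| ≤ 3 := by
    have h1 : |2 * q.re ^ 2| ≤ 2 := by rw [abs_of_nonneg (by positivity)]; nlinarith
    have h2 : |σ * q.re| ≤ 1 := by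
      rw [abs_mul]
      have hs : |σ| = 1 := by rcases hσ with rfl | rfl <;> norm_num
      rw [hs, one_mul]; exact abs_le_of_sq_le_sq (by simpa using hq0) zero_le_one
    calc |2 * q.re ^ 2 - σ * q.re| ≤ |2 * q.re ^ 2| + |σ * q.re| := abs_sub _ _
      _ ≤ 3 := by linarith
  -- the main term is non-negative
  have hmain : 0 ≤ σ * q.re * P2 := mul_nonneg hσq hP2n
  -- assemble
  have hA : -(2 * ‖q - c‖) ≤ (-(2 * q.re * P2)) * (q.re - c.re) := by
    have h := abs_mul (-(2 * q.re * P2)) (q.re - c.re)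
    have hb : |(-(2 * q.re * P2)) * (q.re - c.re)| ≤ 2 * ‖q - c‖ := by
      rw [h]; exact mul_le_mul hα hd0 (abs_nonneg _) (by norm_num)
    linarith [neg_abs_le ((-(2 * q.re * P2)) * (q.re - c.re))]
  have hB : -(3 * ‖q - c‖) ≤ (2 * q.re ^ 2 - σ * q.re) * pd := by
    have h := abs_mul (2 * q.re ^ 2 - σ * q.re) pd
    have hb : |(2 * q.re ^ 2 - σ * q.re) * pd| ≤ 3 * ‖q - c‖ := by
      rw [h]; exact mul_le_mul hβ hpd (abs_nonneg _) (by norm_num)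
    linarith [neg_abs_le ((2 * q.re ^ 2 - σ * q.re) * pd)]
  linarith

/-! ## §2 (P4) for the explicit central field -/

omit [NeZero L] in
/-- The slice-0 wrap edge of direction `k` sits at a site with `x_k = −1` and has direction `k`. [folklore] -/
theorem wrapEdge_eq (k : Fin 3) : wrapEdge (L := L) k = ((wrapEdge (L := L) k).1, k) ∧ (wrapEdge (L := L) k).1 k = -1 := by
  fin_cases k
  · simp [wrapEdge, mk3]
  · simp [wrapEdge, mk3]
  · simp [wrapEdge, mk3]

omit [NeZero L] in
/-- `√17·16 ≤ 66` and `√17·12 ≤ 50`. [folklore] -/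
theorem sqrt17_bounds : Real.sqrt 17 * 16 ≤ 66 ∧ Real.sqrt 17 * 12 ≤ 50 := by
  have h : Real.sqrt 17 ≤ 33 / 8 := by
    rw [show (33 : ℝ) / 8 = Real.sqrt ((33 / 8) ^ 2) by rw [Real.sqrt_sq (by norm_num)]]
    exact Real.sqrt_le_sqrt (by norm_num)
  exact ⟨by linarith, by linarith⟩

/-- ★★ **(P4) at a slice-0 wrap link for the explicit central field.**  At an `X_fix` point `x` with the sign hypothesis `½ ≤ σ_k·Re q(w_k)`
(`σ_k = ±1`) and `|z_k|² ≤ ½` (`z_k` the wrap-block average): `−330·L²·√F_fix(x) ≤ Σ_va centralCoeff L σ σ₄ va M_x · ∂_va m_k(M_x)`.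
[cite: Luscher1983, §2] -/
theorem central_linkMass_bracket_lower {σ : Fin 3 → ℝ} (hσ : ∀ k, σ k = 1 ∨ σ k = -1) (σ₄ : ℝ)
    (x : (OffIdx L → SU2) × ((Fin (2 * L - 1) → GaugeConfig 3 L SU2) × (Site 3 L → SU2))) (k : Fin 3)
    (hhem : (1 / 2 : ℝ) ≤ σ k * (su2Quat (wrapReps ((Fin.cons (glue x.1) x.2.1 : Fin (2 * L - 1 + 1) → GaugeConfig 3 L SU2) 0) k)).re)
    (hz : (blockIm L (wrapBlock L k) k ((Fin.cons (glue x.1) x.2.1 : Fin (2 * L - 1 + 1) → GaugeConfig 3 L SU2), x.2.2) 0) ^ 2 +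
      (blockIm L (wrapBlock L k) k ((Fin.cons (glue x.1) x.2.1 : Fin (2 * L - 1 + 1) → GaugeConfig 3 L SU2), x.2.2) 1) ^ 2 +
      (blockIm L (wrapBlock L k) k ((Fin.cons (glue x.1) x.2.1 : Fin (2 * L - 1 + 1) → GaugeConfig 3 L SU2), x.2.2) 2) ^ 2 ≤ 1 / 2) :
    -(330 * (L : ℝ) ^ 2 * Real.sqrt (ringDeficit L (fun _ => false) ((Fin.cons (glue x.1) x.2.1 : Fin (2 * L - 1 + 1) → GaugeConfig 3 L SU2), x.2.2))) ≤
      ∑ va, centralCoeff L σ σ₄ va (ringCoord L ((Fin.cons (glue x.1) x.2.1 : Fin (2 * L - 1 + 1) → GaugeConfig 3 L SU2), x.2.2)) *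
        frameD (fixFrameStd va) (linkMass k) (ringCoord L ((Fin.cons (glue x.1) x.2.1 : Fin (2 * L - 1 + 1) → GaugeConfig 3 L SU2), x.2.2)) := by
  set P : (Fin (2 * L - 1 + 1) → GaugeConfig 3 L SU2) × (Site 3 L → SU2) :=
    ((Fin.cons (glue x.1) x.2.1 : Fin (2 * L - 1 + 1) → GaugeConfig 3 L SU2), x.2.2) with hPdef
  set z := blockIm L (wrapBlock L k) k P with hzdef
  obtain ⟨hwe, hwk⟩ := wrapEdge_eq (L := L) k
  -- slice 0 is in comb gauge
  have hP0 : P.1 0 = glue x.1 := by simp [hPdef]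
  have ht : treeGauge (P.1 0) = 1 := by rw [hP0]; funext y; exact treeGauge_glue x.1 y
  have hw : wrapReps (P.1 0) k = P.1 0 (wrapEdge k) := by rw [RegCutoff.wrapReps_eq, treeFix_eq_self_of_treeGauge_eq_one ht]
  -- the slot direction of the field at the wrap link
  have hπ : su2Quat ((centralProj L σ σ₄ P).1 0 ((wrapEdge (L := L) k).1, k)) = liftQuat (σ k) z := by
    show su2Quat (combFlat (fun k => centralRep (σ k) (blockIm L (wrapBlock L k) k P)) ((wrapEdge (L := L) k).1, k)) = _
    rw [combFlat_apply, if_pos hwk, su2Quat_centralRep (sq_eq_one_of_sign (hσ k)) (normSq_blockIm_le_one _ k P)]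
  have hdir : dirOf (fixFrameStd (L := L)) (fun va => centralCoeff L σ σ₄ va (ringCoord L P)) (Sum.inl (0, wrapEdge k)) =
      quatMatrix ⟨0,
        (star (liftQuat (σ k) z) * su2Quat (P.1 0 (wrapEdge k))).imI + (1 / 2 : ℝ) * σ k * z 0,
        (star (liftQuat (σ k) z) * su2Quat (P.1 0 (wrapEdge k))).imJ + (1 / 2 : ℝ) * σ k * z 1,
        (star (liftQuat (σ k) z) * su2Quat (P.1 0 (wrapEdge k))).imK + (1 / 2 : ℝ) * σ k * z 2⟩ := by
    rw [dirOf_fixFrameStd_centralCoeff, hwe, centralDir_wrap hσ σ₄ P 0 hwk (by rw [hzdef] at hz; exact hz), hπ]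
  rw [sum_mul_frameD_linkMass_quat fixFrameStd (fun va => centralCoeff L σ σ₄ va (ringCoord L P)) k P rfl hdir]
  -- the anchored bracket bound
  set q := su2Quat (P.1 0 (wrapEdge k)) with hqdef
  have hq1 : q.re ^ 2 + q.imI ^ 2 + q.imJ ^ 2 + q.imK ^ 2 = 1 := by
    have h1 : Quaternion.normSq q = 1 := normSq_su2Quat _
    rw [Quaternion.normSq_def'] at h1
    simpa only [sq] using h1
  have hσq : 0 ≤ σ k * q.re := by rw [hqdef, ← hw]; linarith
  have hbr := anchored_bracket_lower q (liftQuat (σ k) z) (hσ k) hq1 hσq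
  have hcI : (liftQuat (σ k) z).imI = z 0 := rfl
  have hcJ : (liftQuat (σ k) z).imJ = z 1 := rfl
  have hcK : (liftQuat (σ k) z).imK = z 2 := rfl
  rw [hcI, hcJ, hcK] at hbr
  -- proximity `‖q − c‖ ≤ √17·16L²√F`
  have hprox := norm_sq_wrapRep_sub_lift_blockIm_le P ht (hσ k) k hhem
  rw [hw] at hprox
  have hδ0 : 0 ≤ 16 * (L : ℝ) ^ 2 * Real.sqrt (ringDeficit L (fun _ => false) P) := by positivity
  have hn : ‖q - liftQuat (σ k) z‖ ≤ Real.sqrt 17 * (16 * (L : ℝ) ^ 2 * Real.sqrt (ringDeficit L (fun _ => false) P)) := by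
    have h2 : ‖q - liftQuat (σ k) z‖ ^ 2 ≤ (Real.sqrt 17 * (16 * (L : ℝ) ^ 2 * Real.sqrt (ringDeficit L (fun _ => false) P))) ^ 2 := by
      rw [mul_pow, Real.sq_sqrt (by norm_num)]; exact hprox
    exact (pow_le_pow_iff_left₀ (norm_nonneg _) (by positivity) two_ne_zero).1 h2
  have h66 := sqrt17_bounds.1
  have hF0 : 0 ≤ Real.sqrt (ringDeficit L (fun _ => false) P) := Real.sqrt_nonneg _
  have hL2 : 0 ≤ (L : ℝ) ^ 2 := by positivity
  have hn' : ‖q - liftQuat (σ k) z‖ ≤ 66 * (L : ℝ) ^ 2 * Real.sqrt (ringDeficit L (fun _ => false) P) := by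
    calc ‖q - liftQuat (σ k) z‖ ≤ Real.sqrt 17 * (16 * (L : ℝ) ^ 2 * Real.sqrt (ringDeficit L (fun _ => false) P)) := hn
      _ = (Real.sqrt 17 * 16) * ((L : ℝ) ^ 2 * Real.sqrt (ringDeficit L (fun _ => false) P)) := by ring
      _ ≤ 66 * ((L : ℝ) ^ 2 * Real.sqrt (ringDeficit L (fun _ => false) P)) := mul_le_mul_of_nonneg_right h66 (by positivity)
      _ = 66 * (L : ℝ) ^ 2 * Real.sqrt (ringDeficit L (fun _ => false) P) := by ring
  linarith

/-- ★★ **(P4) at the seam root for the explicit central field** (seam twin, `12L²` in place of `16L²`):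
`−330·L²·√F_fix(x) ≤ Σ_va centralCoeff L σ σ₄ va M_x · ∂_va m_seam(M_x)` under `½ ≤ σ₄·Re q(seam root)`, `|z₄|² ≤ ½`. [cite: Luscher1983, §2] -/
theorem central_seamMass_bracket_lower (σ : Fin 3 → ℝ) {σ₄ : ℝ} (hσ₄ : σ₄ = 1 ∨ σ₄ = -1)
    (x : (OffIdx L → SU2) × ((Fin (2 * L - 1) → GaugeConfig 3 L SU2) × (Site 3 L → SU2)))
    (hhem : (1 / 2 : ℝ) ≤ σ₄ * (su2Quat (x.2.2 0)).re)
    (hz : (seamIm L ((Fin.cons (glue x.1) x.2.1 : Fin (2 * L - 1 + 1) → GaugeConfig 3 L SU2), x.2.2) 0) ^ 2 +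
      (seamIm L ((Fin.cons (glue x.1) x.2.1 : Fin (2 * L - 1 + 1) → GaugeConfig 3 L SU2), x.2.2) 1) ^ 2 +
      (seamIm L ((Fin.cons (glue x.1) x.2.1 : Fin (2 * L - 1 + 1) → GaugeConfig 3 L SU2), x.2.2) 2) ^ 2 ≤ 1 / 2) :
    -(330 * (L : ℝ) ^ 2 * Real.sqrt (ringDeficit L (fun _ => false) ((Fin.cons (glue x.1) x.2.1 : Fin (2 * L - 1 + 1) → GaugeConfig 3 L SU2), x.2.2))) ≤
      ∑ va, centralCoeff L σ σ₄ va (ringCoord L ((Fin.cons (glue x.1) x.2.1 : Fin (2 * L - 1 + 1) → GaugeConfig 3 L SU2), x.2.2)) *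
        frameD (fixFrameStd va) seamMass (ringCoord L ((Fin.cons (glue x.1) x.2.1 : Fin (2 * L - 1 + 1) → GaugeConfig 3 L SU2), x.2.2)) := by
  set P : (Fin (2 * L - 1 + 1) → GaugeConfig 3 L SU2) × (Site 3 L → SU2) :=
    ((Fin.cons (glue x.1) x.2.1 : Fin (2 * L - 1 + 1) → GaugeConfig 3 L SU2), x.2.2) with hPdef
  set z := seamIm L P with hzdef
  have hP0 : P.1 0 = glue x.1 := by simp [hPdef]
  have ht : treeGauge (P.1 0) = 1 := by rw [hP0]; funext y; exact treeGauge_glue x.1 y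
  have hπ : su2Quat ((centralProj L σ σ₄ P).2 0) = liftQuat σ₄ z := by
    show su2Quat (centralRep σ₄ (seamIm L P)) = _
    rw [su2Quat_centralRep (sq_eq_one_of_sign hσ₄) (normSq_seamIm_le_one P)]
  have hdir : dirOf (fixFrameStd (L := L)) (fun va => centralCoeff L σ σ₄ va (ringCoord L P)) (Sum.inr 0) =
      quatMatrix ⟨0,
        (star (liftQuat σ₄ z) * su2Quat (P.2 0)).imI + (1 / 2 : ℝ) * σ₄ * z 0,
        (star (liftQuat σ₄ z) * su2Quat (P.2 0)).imJ + (1 / 2 : ℝ) * σ₄ * z 1,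
        (star (liftQuat σ₄ z) * su2Quat (P.2 0)).imK + (1 / 2 : ℝ) * σ₄ * z 2⟩ := by
    rw [dirOf_fixFrameStd_centralCoeff, centralDir_seam σ hσ₄ P 0 (by rw [hzdef] at hz; exact hz), hπ]
  rw [sum_mul_frameD_seamMass_quat fixFrameStd (fun va => centralCoeff L σ σ₄ va (ringCoord L P)) P rfl hdir]
  set q := su2Quat (P.2 0) with hqdef
  have hq1 : q.re ^ 2 + q.imI ^ 2 + q.imJ ^ 2 + q.imK ^ 2 = 1 := by
    have h1 : Quaternion.normSq q = 1 := normSq_su2Quat _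
    rw [Quaternion.normSq_def'] at h1
    simpa only [sq] using h1
  have hσq : 0 ≤ σ₄ * q.re := by rw [hqdef]; linarith
  have hbr := anchored_bracket_lower q (liftQuat σ₄ z) hσ₄ hq1 hσq
  have hcI : (liftQuat σ₄ z).imI = z 0 := rfl
  have hcJ : (liftQuat σ₄ z).imJ = z 1 := rfl
  have hcK : (liftQuat σ₄ z).imK = z 2 := rfl
  rw [hcI, hcJ, hcK] at hbr
  have hprox := norm_sq_seam_sub_lift_seamIm_le P ht hσ₄ hhem
  have hn : ‖q - liftQuat σ₄ z‖ ≤ Real.sqrt 17 * (12 * (L : ℝ) ^ 2 * Real.sqrt (ringDeficit L (fun _ => false) P)) := by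
    have h2 : ‖q - liftQuat σ₄ z‖ ^ 2 ≤ (Real.sqrt 17 * (12 * (L : ℝ) ^ 2 * Real.sqrt (ringDeficit L (fun _ => false) P))) ^ 2 := by
      rw [mul_pow, Real.sq_sqrt (by norm_num)]; exact hprox
    exact (pow_le_pow_iff_left₀ (norm_nonneg _) (by positivity) two_ne_zero).1 h2
  have h50 := sqrt17_bounds.2
  have hF0 : 0 ≤ Real.sqrt (ringDeficit L (fun _ => false) P) := Real.sqrt_nonneg _
  have hL2 : 0 ≤ (L : ℝ) ^ 2 := by positivity
  have hn' : ‖q - liftQuat σ₄ z‖ ≤ 50 * (L : ℝ) ^ 2 * Real.sqrt (ringDeficit L (fun _ => false) P) := by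
    calc ‖q - liftQuat σ₄ z‖ ≤ Real.sqrt 17 * (12 * (L : ℝ) ^ 2 * Real.sqrt (ringDeficit L (fun _ => false) P)) := hn
      _ = (Real.sqrt 17 * 12) * ((L : ℝ) ^ 2 * Real.sqrt (ringDeficit L (fun _ => false) P)) := by ring
      _ ≤ 50 * ((L : ℝ) ^ 2 * Real.sqrt (ringDeficit L (fun _ => false) P)) := mul_le_mul_of_nonneg_right h50 (by positivity)
      _ = 50 * (L : ℝ) ^ 2 * Real.sqrt (ringDeficit L (fun _ => false) P) := by ring
  nlinarith [hL2, hF0]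

end Summit.QuantumFields.YangMills.Theorems.VirialFluxGap.FrameHessian

end
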